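import Summits.QuantumFields.YangMills.Theorems.BalabanUVNodesN15KingModelGraphTreeDecayExtensiveFields
import Summits.QuantumFields.YangMills.Theorems.BalabanUVNodesN15KingModelGraphTreeDecayContinuumKernel

/-!
# BalabanUVNodes ∕ N15 — THE KING-MODEL RUNG (PART Β-g): THE `K → ∞` LIMIT OF A DIAGRAM PAIRED WITH A BOUNDED UNIT-LATTICE FIELD EXISTS — THEOREM 3.4 ⇒ THEOREM 2.1 (i)
# FOR ONE DIAGRAM's CONTRIBUTION TO THE EFFECTIVE ACTION ((3.40) at `K + 1` scales along `K`), WITH THE RATE `C·|T|·Φ^{r+1}·(L^{−γ})^K`, BY NAME AT `A = 0`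
# (Track A, DAG node N15 = NE2; FAN-OUT v1.1 §N15 s3 «KING-MODEL RUNG … NE2's analogue DECIDED in the model»)

HONEST FRAMING.  Count-neutral (cell `pub-ymgap`, seat `pub-ymgap-dag-n15-e` g30; `--supports stmt-QuantumFields-27366 --as helper` = K3⁸
`SpineGivenEndpointR13SepCoPHV`).  TEMPLATE LITERATURE: C. King, *The U(1) Higgs model. I. The continuum limit*, Commun. Math. Phys. **102** (1986) 649–677
[King1986]: (3.40) p. 660 (a diagram paired with the unit-lattice field `φ^{(k)}`), Theorem 3.4 (3.9) p. 656, Theorem 2.1 (i) (2.22) p. 654 with (3.10)–(3.13)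
pp. 656–657 — run on ONE DIAGRAM of KING's OWN `A = 0` MODEL at fixed volume `2L^{e_M}`: the field-paired sum of part Β-b along `K` (legs = King's (3.71) kernels,
parts Η-e∕Α-g; transport of the legs = part Β-e).  NOT `Z` ∕ the effective action as a whole, NOT Bałaban's `G(U)`, NOT a node discharge; «continuum» = King's
`κ → ∞` at fixed torus; nothing continuum-ℝ⁴ ∕ OS ∕ mass-gap ∕ Clay.  0 `sorry`; standard axioms.  Pages re-read 2026-08-29.

THE PRINT.  p. 660 [PDF 12] (3.40): *«E^{(k+n)}(H) − E^{(k)}(H) = Σ_{y_1,…,y_s ∈ T^{(k)}} … φ^{(k)}(y_1)⋯φ^{(k)}(y_s){E^{(k+n)}(H; {y_i}, …) − E^{(k)}(H; {y_i}, …)}»*; p. 657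
(3.13): *«Hence {Z^{ε_κ}} is a Cauchy sequence and converges to a unique limit as κ → ∞.»*

READING (declared; ours).  `kingFieldSeq K := Σ_{y₀} Σ_{w} φ(y₀)Π_lφ(w_l)·E^{(K+1)}(G; y₀, w)` — the diagram with `1 + r` scalar legs paired with ONE unit-lattice field
`|φ| ≤ Φ` (King's (3.40) has one scalar species), `K + 1` coarse scales, torus `2L^{e_M}`.  By part Β-e's transport (`kingExtHi_jvSucc_eq`, leg by leg on
`Unit ⊕ Fin r`) the `(K+2)`-term IS part Β-b's fine term at index `jvSucc e_M K`, `n = 1`; hence part Β-b `king_graph_fields_rate_extensive` bounds the consecutive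
difference by `(|T|·L^{−γ}·Φ·C^{2m+nn+1+r}·m!·(m+r+2)·(Φ(1+4r∕δ)e^{δ∕4r}K_{d+1}(δ∕4r))^r)·(L^{−γ})^K` ⇒ ★★★ the limit `S^{(∞)}(G, φ)` EXISTS with
`|S^{(K+1)} − S^{(∞)}| ≤ C·r^K∕(1−r)` — Theorem 3.4 ⇒ Theorem 2.1 (i) for one diagram's field-paired contribution; §3: NO hypothesis for connected pseudoforests of
`G`-lines in `1 ≤ d ≤ 3`.

WHAT THIS FILE PROVES (namespace `Summit.QuantumFields.YangMills.BalabanUVNodes.N15KingModelRung.Curved`).  §1 ★ `kingExtLo_jvSucc_succ_eq` (function-level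
transport, Lo at `K+1` ↦ Hi at `(K, 1)`), `kingFieldSeq`, ★ `kingFieldSeq_succ_sub_le`.  §2 ★★★ **`king_graph_fields_continuumLimit`**.  §3 ★★
`king_pseudoforest_fields_continuumLimit`.

HONEST SCOPE.  (a) One diagram, one field species `φ` with a sup bound, King's `A = 0` model at fixed torus; the `|T|` in the constant is the finite volume (the sum
over the root site), NOT removed here (part Β-f removes it for the vacuum density); p. 664's sentence is the hypothesis (discharged in §3); §3.5 not typed.
(b) NOT Bałaban's `G(U)`; N15 untouched; counts unmoved.
Locators: [King1986] (3.40)–(3.42) p.660, Thm 3.4 (3.9) p.656, Thm 2.1 (i) (2.22) p.654, (3.10)–(3.13) pp.656–657, Prop. 3.6 (3.56) p.662, p.664, Prop. 3.8 (3.71) p.664.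
-/

noncomputable section

open scoped BigOperators Topology
open Finset Filter

namespace Summit.QuantumFields.YangMills.BalabanUVNodes.N15KingModelRung.Curved

open Literature.MathematicalPhysics.QuantumFieldTheory.Balaban1983to89.B4Sect5Proof (latticeConst latticeConst_nonneg)
open Literature.MathematicalPhysics.QuantumFieldTheory.Balaban1983to89.B5Prop11Plancherel (Tor fine)
open Summit.QuantumFields.YangMills.BalabanUVNodes.N15KingModelRung (KingVolIndex kingVol kingVol_neZero)
open Summit.QuantumFields.YangMills.BalabanUVNodes.N15KingModelRung.Graph

variable {d : ℕ} (L : ℕ) [NeZero L]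

/-! ## §1 The field-paired diagram along `K` and its geometric consecutive differences -/

section Objects

/-- ★ **FUNCTION-LEVEL TRANSPORT**: the coarse leg at index `jvSucc e_M (K+1)` IS the fine leg at `(jvSucc e_M K, n = 1)` (part Β-e `kingExtHi_jvSucc_eq`, as functions).
[cite: King1986, Prop. 3.8 (3.71) p.664] -/
theorem kingExtLo_jvSucc_succ_eq (a msq : ℝ) (eM K : ℕ) (b : Tor (kingVol L (jvSucc (d := d) eM 0))) (κ : Option (Fin (d + 1))) :
    kingExtLo L a msq (jvSucc (d := d) eM (K + 1)) b κ = kingExtHi L a msq (jvSucc (d := d) eM K) 1 b κ :=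
  funext fun x' => (kingExtHi_jvSucc_eq L a msq eM K b κ x').symm

/-- **THE FIELD-PAIRED DIAGRAM ALONG `K`** ((3.40) at `K + 1` scales): `Σ_{y₀} Σ_w φ(y₀)·Π_l φ(w_l)·E^{(K+1)}(G; y₀, w)` — root leg of kind `κ₀` at the vertex `0`, `r`
further legs at vertices `vtxF` of kinds `κF`, torus `2L^{e_M}`. [cite: King1986, (3.40) p.660, Prop. 3.8 (3.71) p.664] -/
def kingFieldSeq (a msq : ℝ) (eM nn m : ℕ) (src tgt : Fin m → Fin (nn + 1)) (κ : Fin m → Option (Fin (d + 1))) (κ₀ : Option (Fin (d + 1)))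
    (r : ℕ) (vtxF : Fin r → Fin (nn + 1)) (κF : Fin r → Option (Fin (d + 1))) (φ : Tor (kingVol L (jvSucc (d := d) eM 0)) → ℝ) (K : ℕ) : ℝ :=
  haveI := kingVol_neZero L (jvSucc (d := d) eM K)
  ∑ y₀ : Tor (kingVol L (jvSucc (d := d) eM K)), ∑ w : Fin r → Tor (kingVol L (jvSucc (d := d) eM K)), (φ y₀ * ∏ l, φ (w l))
    * graphValLS ((((L : ℝ) ^ (K + 1))⁻¹) ^ (d + 1)) src tgt (fun ℓ => kingGLine L (kingVol L (jvSucc (d := d) eM K)) a msq (K + 1) (κ ℓ))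
        (Sum.elim (fun _ : Unit => (0 : Fin (nn + 1))) vtxF)
        (fun υ => kingExtLo L a msq (jvSucc (d := d) eM K) (Sum.elim (fun _ : Unit => y₀) w υ) (Sum.elim (fun _ : Unit => κ₀) κF υ))

/-- ★ **CONSECUTIVE DIFFERENCES: GEOMETRIC IN `K`**: with part Β-b's `(C, γ, δ)`, under p. 664's sentence, for `r ≥ 1`, `|φ| ≤ Φ` and every `K`:
`|S^{(K+2)} − S^{(K+1)}| ≤ ((2L^{e_M})^{d+1}·L^{−γ}·(Φ·C^{2m+nn+(1+r)}·m!·(m+(1+r)+1))·(Φ(1+4r∕δ)e^{δ∕4r}K_{d+1}(δ∕4r))^r)·(L^{−γ})^K` — part Β-b at `(jvSucc e_M K, n = 1)`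
after §1's transport of the `1 + r` legs. [cite: King1986, (3.40)–(3.42) p.660, Thm 3.4 (3.9) p.656, (3.10)–(3.11) p.656] -/
theorem kingFieldSeq_succ_sub_le (hLodd : Odd L) (hL : 2 ≤ L) {a : ℝ} (ha : 0 < a) {m0sq : ℝ} (hm0 : 0 ≤ m0sq) :
    ∃ C γ δ : ℝ, 1 ≤ C ∧ 0 < γ ∧ 0 < δ ∧ ∀ (msq : ℝ), 0 < msq → msq ≤ m0sq → ∀ (eM nn m : ℕ) (src tgt : Fin m → Fin (nn + 1)), (∀ v, LConn src tgt univ 0 v) →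
      ∀ (κ : Fin m → Option (Fin (d + 1))), PosSubgraphsBy src tgt 0 ((d + 1 : ℕ) : ℝ) (fun ℓ => lineExp (d + 1) (κ ℓ)) →
      ∀ (κ₀ : Option (Fin (d + 1))) (r : ℕ), 1 ≤ r → ∀ (vtxF : Fin r → Fin (nn + 1)) (κF : Fin r → Option (Fin (d + 1)))
        (Φ : ℝ), 0 ≤ Φ → ∀ (φ : Tor (kingVol L (jvSucc (d := d) eM 0)) → ℝ), (∀ y, |φ y| ≤ Φ) → ∀ K : ℕ,
        |kingFieldSeq L a msq eM nn m src tgt κ κ₀ r vtxF κF φ (K + 1) - kingFieldSeq L a msq eM nn m src tgt κ κ₀ r vtxF κF φ K|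
          ≤ ((2 * (L : ℝ) ^ eM) ^ (d + 1) * (L : ℝ) ^ (-γ)
              * ((Φ * (C ^ (2 * m + nn + (1 + r)) * ((m.factorial : ℝ) * (m + (1 + r) + 1))))
                * (Φ * (1 + 4 * r / δ) * (Real.exp (δ / (4 * r)) * latticeConst (d + 1) (δ / (4 * r)))) ^ r)) * ((L : ℝ) ^ (-γ)) ^ K := by
  obtain ⟨C, γ, δ, hC, hγ, hδ, H⟩ := king_graph_fields_rate_extensive (d := d) L hLodd hL ha hm0
  refine ⟨C, γ, δ, hC, hγ, hδ, fun msq hm hcap eM nn m src tgt hconn κ hsub κ₀ r hr vtxF κF Φ hΦ φ hφ K => ?_⟩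
  set jv : KingVolIndex d := jvSucc (d := d) eM K with hjv
  haveI := kingVol_neZero L jv
  have key := H msq hm hcap jv 1 le_rfl nn m src tgt hconn κ hsub κ₀ r hr vtxF κF Φ hΦ φ hφ
  -- the `(K+2)`-term is the fine term at `(jv, n = 1)` by the transport of the legs; the `(K+1)`-term is the coarse term on the nose
  have hHi : kingFieldSeq L a msq eM nn m src tgt κ κ₀ r vtxF κF φ (K + 1)
      = ∑ y₀ : Tor (kingVol L jv), ∑ w : Fin r → Tor (kingVol L jv), (φ y₀ * ∏ l, φ (w l))
          * graphValLS ((((L : ℝ) ^ (jv.K + 1))⁻¹) ^ (d + 1)) src tgt (fun ℓ => kingGLine L (kingVol L jv) a msq (jv.K + 1) (κ ℓ))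
              (Sum.elim (fun _ : Unit => (0 : Fin (nn + 1))) vtxF)
              (fun υ => kingExtHi L a msq jv 1 (Sum.elim (fun _ : Unit => y₀) w υ) (Sum.elim (fun _ : Unit => κ₀) κF υ)) := by
    unfold kingFieldSeq
    simp only [kingExtLo_jvSucc_succ_eq]
    rfl
  have hLo : kingFieldSeq L a msq eM nn m src tgt κ κ₀ r vtxF κF φ K
      = ∑ y₀ : Tor (kingVol L jv), ∑ w : Fin r → Tor (kingVol L jv), (φ y₀ * ∏ l, φ (w l))
          * graphValLS ((((L : ℝ) ^ jv.K)⁻¹) ^ (d + 1)) src tgt (fun ℓ => kingGLine L (kingVol L jv) a msq jv.K (κ ℓ))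
              (Sum.elim (fun _ : Unit => (0 : Fin (nn + 1))) vtxF)
              (fun υ => kingExtLo L a msq jv (Sum.elim (fun _ : Unit => y₀) w υ) (Sum.elim (fun _ : Unit => κ₀) κF υ)) := rfl
  rw [hHi, hLo, ← sum_sub_distrib]
  simp_rw [← sum_sub_distrib, ← mul_sub]
  have hcard : (Fintype.card (Tor (kingVol L jv)) : ℝ) = (2 * (L : ℝ) ^ eM) ^ (d + 1) := by
    rw [card_unitTorus]; push_cast; rfl
  have hpow : (L : ℝ) ^ (-(γ * (jv.K : ℕ))) = (L : ℝ) ^ (-γ) * ((L : ℝ) ^ (-γ)) ^ K := by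
    rw [show (-(γ * (jv.K : ℕ)) : ℝ) = (-γ) * ((K + 1 : ℕ) : ℝ) from by simp only [hjv, jvSucc]; ring,
      Real.rpow_mul (Nat.cast_nonneg L), Real.rpow_natCast, pow_succ, mul_comm]
  rw [hcard, hpow] at key
  calc _ ≤ _ := key
    _ = _ := by ring

end Objects

/-! ## §2 Theorem 3.4 ⇒ Theorem 2.1 (i) for one field-paired diagram -/

section Limit

/-- ★★★ **THE `K → ∞` LIMIT OF A FIELD-PAIRED DIAGRAM EXISTS, WITH THE RATE — THEOREM 3.4 ⇒ THEOREM 2.1 (i)'s «∃ lim_{κ→∞}» FOR ONE DIAGRAM's CONTRIBUTION TO THE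
EFFECTIVE ACTION, BY NAME AT `A = 0`.**  For odd `L ≥ 3`, `a > 0`, `m₀² ≥ 0` there are `C ≥ 1`, `γ, δ > 0` such that for every mass `0 < m² ≤ m₀²`, volume exponent `e_M`,
CONNECTED numbered graph under p. 664's sentence, root kind `κ₀`, `r ≥ 1` legs (`vtxF`, `κF`) and field `|φ| ≤ Φ`, there is `S^{(∞)} ∈ ℝ` with
`S^{(K+1)}(G, φ) → S^{(∞)}` and `|S^{(K+1)}(G, φ) − S^{(∞)}| ≤ ((2L^{e_M})^{d+1}·L^{−γ}·Φ·C^{2m+nn+1+r}·m!·(m+r+2)·(Φ(1+4r∕δ)e^{δ∕4r}K_{d+1}(δ∕4r))^r)·(L^{−γ})^K∕(1−L^{−γ})`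
— §1 + Mathlib's `cauchySeq_of_le_geometric` ∕ `dist_le_of_le_geometric_of_tendsto`. [cite: King1986, Thm 2.1 (i) (2.22) p.654, (3.13) p.657, Thm 3.4 (3.9) p.656, (3.40) p.660] -/
theorem king_graph_fields_continuumLimit (hLodd : Odd L) (hL : 2 ≤ L) {a : ℝ} (ha : 0 < a) {m0sq : ℝ} (hm0 : 0 ≤ m0sq) :
    ∃ C γ δ : ℝ, 1 ≤ C ∧ 0 < γ ∧ 0 < δ ∧ ∀ (msq : ℝ), 0 < msq → msq ≤ m0sq → ∀ (eM nn m : ℕ) (src tgt : Fin m → Fin (nn + 1)), (∀ v, LConn src tgt univ 0 v) →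
      ∀ (κ : Fin m → Option (Fin (d + 1))), PosSubgraphsBy src tgt 0 ((d + 1 : ℕ) : ℝ) (fun ℓ => lineExp (d + 1) (κ ℓ)) →
      ∀ (κ₀ : Option (Fin (d + 1))) (r : ℕ), 1 ≤ r → ∀ (vtxF : Fin r → Fin (nn + 1)) (κF : Fin r → Option (Fin (d + 1)))
        (Φ : ℝ), 0 ≤ Φ → ∀ (φ : Tor (kingVol L (jvSucc (d := d) eM 0)) → ℝ), (∀ y, |φ y| ≤ Φ) →
      ∃ Sinf : ℝ, Tendsto (kingFieldSeq L a msq eM nn m src tgt κ κ₀ r vtxF κF φ) atTop (𝓝 Sinf) ∧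
        ∀ K : ℕ, |kingFieldSeq L a msq eM nn m src tgt κ κ₀ r vtxF κF φ K - Sinf|
          ≤ ((2 * (L : ℝ) ^ eM) ^ (d + 1) * (L : ℝ) ^ (-γ)
              * ((Φ * (C ^ (2 * m + nn + (1 + r)) * ((m.factorial : ℝ) * (m + (1 + r) + 1))))
                * (Φ * (1 + 4 * r / δ) * (Real.exp (δ / (4 * r)) * latticeConst (d + 1) (δ / (4 * r)))) ^ r)) * ((L : ℝ) ^ (-γ)) ^ K
            / (1 - (L : ℝ) ^ (-γ)) := by
  obtain ⟨C, γ, δ, hC, hγ, hδ, H⟩ := kingFieldSeq_succ_sub_le (d := d) L hLodd hL ha hm0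
  refine ⟨C, γ, δ, hC, hγ, hδ, fun msq hm hcap eM nn m src tgt hconn κ hsub κ₀ r hr vtxF κF Φ hΦ φ hφ => ?_⟩
  have hL1r : (1 : ℝ) < L := by exact_mod_cast (show 1 < L by omega)
  have hr1 : (L : ℝ) ^ (-γ) < 1 := Real.rpow_lt_one_of_one_lt_of_neg hL1r (by linarith)
  set B : ℝ := (2 * (L : ℝ) ^ eM) ^ (d + 1) * (L : ℝ) ^ (-γ)
      * ((Φ * (C ^ (2 * m + nn + (1 + r)) * ((m.factorial : ℝ) * (m + (1 + r) + 1))))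
        * (Φ * (1 + 4 * r / δ) * (Real.exp (δ / (4 * r)) * latticeConst (d + 1) (δ / (4 * r)))) ^ r) with hB
  have hdist : ∀ K, dist (kingFieldSeq L a msq eM nn m src tgt κ κ₀ r vtxF κF φ K) (kingFieldSeq L a msq eM nn m src tgt κ κ₀ r vtxF κF φ (K + 1))
      ≤ B * ((L : ℝ) ^ (-γ)) ^ K := fun K => by
    rw [Real.dist_eq, abs_sub_comm]; exact H msq hm hcap eM nn m src tgt hconn κ hsub κ₀ r hr vtxF κF Φ hΦ φ hφ K
  obtain ⟨Sinf, hlim⟩ := cauchySeq_tendsto_of_complete (cauchySeq_of_le_geometric _ B hr1 hdist)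
  refine ⟨Sinf, hlim, fun K => ?_⟩
  rw [← Real.dist_eq]
  exact dist_le_of_le_geometric_of_tendsto _ B hr1 hdist hlim K

end Limit

/-! ## §3 The hypothesis-free class: connected pseudoforests of `G`-lines, `1 ≤ d ≤ 3` -/

section Pseudoforest

/-- ★★ **THE `K → ∞` LIMIT OF EVERY FIELD-PAIRED CONNECTED PSEUDOFOREST OF `G`-LINES EXISTS, WITH THE RATE — NO HYPOTHESIS** (`1 ≤ d ≤ 3`): §2 with p. 664's sentence
discharged by part Δ-c's counting. [cite: King1986, Thm 2.1 (i) (2.22) p.654, Thm 3.4 (3.9) p.656, (3.40) p.660, p.664] -/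
theorem king_pseudoforest_fields_continuumLimit (hd1 : 1 ≤ d) (hd3 : d ≤ 3) (hLodd : Odd L) (hL : 2 ≤ L) {a : ℝ} (ha : 0 < a)
    {m0sq : ℝ} (hm0 : 0 ≤ m0sq) :
    ∃ C γ δ : ℝ, 1 ≤ C ∧ 0 < γ ∧ 0 < δ ∧ ∀ (msq : ℝ), 0 < msq → msq ≤ m0sq → ∀ (eM nn m : ℕ) (src tgt : Fin m → Fin (nn + 1)), (∀ v, LConn src tgt univ 0 v) →
      (∀ ℓ, src ℓ ≠ tgt ℓ) → (∀ S : Finset (Fin m), S.card ≤ (lineVerts src tgt S).card) →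
      (∀ S : Finset (Fin m), S.card = 2 → 3 ≤ (lineVerts src tgt S).card) →
      ∀ (κ₀ : Option (Fin (d + 1))) (r : ℕ), 1 ≤ r → ∀ (vtxF : Fin r → Fin (nn + 1)) (κF : Fin r → Option (Fin (d + 1)))
        (Φ : ℝ), 0 ≤ Φ → ∀ (φ : Tor (kingVol L (jvSucc (d := d) eM 0)) → ℝ), (∀ y, |φ y| ≤ Φ) →
      ∃ Sinf : ℝ, Tendsto (kingFieldSeq L a msq eM nn m src tgt (fun _ : Fin m => (none : Option (Fin (d + 1)))) κ₀ r vtxF κF φ) atTop (𝓝 Sinf) ∧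
        ∀ K : ℕ, |kingFieldSeq L a msq eM nn m src tgt (fun _ : Fin m => (none : Option (Fin (d + 1)))) κ₀ r vtxF κF φ K - Sinf|
          ≤ ((2 * (L : ℝ) ^ eM) ^ (d + 1) * (L : ℝ) ^ (-γ)
              * ((Φ * (C ^ (2 * m + nn + (1 + r)) * ((m.factorial : ℝ) * (m + (1 + r) + 1))))
                * (Φ * (1 + 4 * r / δ) * (Real.exp (δ / (4 * r)) * latticeConst (d + 1) (δ / (4 * r)))) ^ r)) * ((L : ℝ) ^ (-γ)) ^ K
            / (1 - (L : ℝ) ^ (-γ)) := by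
  obtain ⟨C, γ, δ, hC, hγ, hδ, H⟩ := king_graph_fields_continuumLimit (d := d) L hLodd hL ha hm0
  refine ⟨C, γ, δ, hC, hγ, hδ, fun msq hm hcap eM nn m src tgt hconn h1 h2 h3 => ?_⟩
  exact H msq hm hcap eM nn m src tgt hconn _ (posSubgraphsBy_lineExp_pseudoforest hd1 hd3 h1 h2 h3)

end Pseudoforest

end Summit.QuantumFields.YangMills.BalabanUVNodes.N15KingModelRung.Curved

end
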